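import Summits.CriticalPhenomena.PercolationContinuityZ3.Theorems.PercNearOneGluingNoHeavyLowerTailOneCutCertGraph
import Summits.CriticalPhenomena.PercolationContinuityZ3.Theorems.PercNearOneGluingNoHeavyLowerTailOneCutCertTables

/-!
# `NoHeavyLowerTail` (crux stmt-CriticalPhenomena-4575), certificate programme for the one-cut bound at
# `|A| = 5`: the box-certificate checker and its soundness

Layer 4 of the kernel-checked certificate checker (prim-cert-2).  An INSTANCE is a vertex count `n`,
an observer `o`, a relay list `rel` and a BOX: for every coordinate pair `i` a range
`[a_i, b_i] ∈ {[0,1], [0,½], [½,1]}` for its weight.  A CERTIFICATE is, for every relay pair `p`, a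
nonnegative integer corner table `Λ_p` (a multilinear multiplier in the box coordinates) and one more
table `C` (the multiplier of the hypothesis `E N − 4 ≥ 0`).  `boxCheck` computes the box-transformed
integer tables of `P(a_p ↮ b_p) − P(1 ≤ N ≤ 2)` and of `E N − 4`, the certificate number
`Z = Σ_p KR Λ_p · KR T_p − KR C · KR H` in base `2^s` by fast shifts and big-integer products, and tests
all `3^m` fibre sums through the digits of `Z + K Σ_j (2^s)^j` (`…OneCutCertKronecker`).
`boxCheck_sound`: if the check passes then at every weight vector STRICTLY inside the box with
`E N > 4`, `P(1 ≤ N ≤ 2) ≤ t` whenever every relay–relay cut of the listed pairs has probability `≤ t`.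

Nothing here asserts anything about the crux; instances and their evaluations are in later files.
-/

namespace Summit.CriticalPhenomena.PercolationContinuityZ3.Theorems.OneCutCert

open Finset MeasureTheory
open scoped BigOperators
open Literature.Probability.Percolation Literature.Probability.LatticeModels
open Summit.CriticalPhenomena.PercolationContinuityZ3.Theorems.AdditiveGluing.Negative.Cert

variable {n : ℕ}

/-! ## Box patterns -/

/-- The integer de Casteljau weights of a pattern: `φ d g h = 2 · (corner value ? hi/lo : 1 − hi/lo)`,
i.e. `F: diag(2,2)`, `L: (2,0 / 1,1)`, `H: (1,1 / 0,2)` (rows `g = false, true`; columns `h`). [this work] -/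
def phiZ (d : Fin 3) (g h : Bool) : ℤ :=
  if d.val = 0 then (if g = h then 2 else 0)
  else if d.val = 1 then (if g then 1 else (if h then 0 else 2))
  else (if g then (if h then 2 else 0) else 1)

/-- The weights are twice the corner factors of `boxT`. [this work] -/
theorem phiZ_eq (d : Fin 3) (g h : Bool) :
    (phiZ d g h : ℝ) = 2 * (if h then (if g then hiOf d else loOf d) else 1 - (if g then hiOf d else loOf d)) := by
  unfold phiZ hiOf loOf
  fin_cases d <;> cases g <;> cases h <;> simp <;> norm_num

/-- **The transformed integer table is `2^m · boxT`.** [this work] -/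
theorem boxTr_phiZ_eq {m : ℕ} (φ : Fin m → Fin 3) (l : List ℤ) (hl : l.length = 2 ^ m)
    (g : Fin m → Bool) :
    (tabOf (boxTr m (fun i => phiZ (φ i)) l) g : ℝ) =
      2 ^ m * boxT (fun i => loOf (φ i)) (fun i => hiOf (φ i)) (fun h => (tabOf l h : ℝ)) g := by
  rw [boxTr_eq m _ l hl g]
  unfold boxT ML
  push_cast
  rw [Finset.mul_sum]
  refine Finset.sum_congr rfl fun h _ => ?_
  unfold mono corner
  have : (∏ i, (phiZ (φ i) (g i) (h i) : ℝ)) =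
      2 ^ m * ∏ i, (if h i then (if g i then hiOf (φ i) else loOf (φ i))
        else 1 - (if g i then hiOf (φ i) else loOf (φ i))) := by
    simp_rw [phiZ_eq]
    rw [Finset.prod_mul_distrib, Finset.prod_const, Finset.card_univ, Fintype.card_fin]
  rw [this]
  ring

/-! ## The raw tables of an instance -/

/-- Configuration list of a bitmask corner index. [this work] -/
def cfgM (n : ℕ) (b : ℕ) : List (Fin n × Fin n) :=
  ((List.finRange (mE n)).filter fun i : Fin (mE n) => b.testBit i.val).map (edge n)

/-- The bitmask configuration of `enc2 g` is `cfg g`. [this work] -/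
theorem cfgM_enc2 (g : Fin (mE n) → Bool) : cfgM n (enc2 g) = cfg g := by
  unfold cfgM cfg
  congr 1
  exact List.filter_congr fun i _ => testBit_enc2 g i

/-- Relay count of a configuration list. [this work] -/
def NofCfg (c : List (Fin n × Fin n)) (o : Fin n) (rel : List (Fin n)) : ℕ :=
  (rel.filter fun a : Fin n => ((reachTable n c).getD o 0).testBit a.val).length

/-- Relay count read off a reach table. [this work] -/
def NofRT {n : ℕ} (rt : List ℕ) (o : Fin n) (rel : List (Fin n)) : ℕ :=
  (rel.filter fun a : Fin n => (rt.getD o 0).testBit a.val).length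

/-- `NofCfg` through the reach table. [this work] -/
theorem NofCfg_eq (c : List (Fin n × Fin n)) (o : Fin n) (rel : List (Fin n)) :
    NofCfg c o rel = NofRT (reachTable n c) o rel := rfl

/-- Entry of the table `1[a ↮ b] − 1[1 ≤ N ≤ 2]` from a reach table. [this work] -/
def sepLowOfRT {n : ℕ} (o : Fin n) (rel : List (Fin n)) (a b : Fin n) (rt : List ℕ) : ℤ :=
  let N := NofRT rt o rel
  (if (rt.getD a 0).testBit b then 0 else 1) - (if 1 ≤ N ∧ N ≤ 2 then 1 else 0)

/-- The reach tables of all bitmask corners (computed once, shared by all tables). [this work] -/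
def baseRT (n : ℕ) : List (List ℕ) := (List.range (2 ^ mE n)).map fun m => reachTable n (cfgM n m)

/-- Raw integer table of `1[a ↮ b] − 1[1 ≤ N ≤ 2]`, indexed by bitmask. [this work] -/
def rawSepLow (n : ℕ) (o : Fin n) (rel : List (Fin n)) (a b : Fin n) : List ℤ :=
  (List.range (2 ^ mE n)).map fun m => sepLowOfRT o rel a b (reachTable n (cfgM n m))

/-- Raw integer table of `N − 4`, indexed by bitmask. [this work] -/
def rawH (n : ℕ) (o : Fin n) (rel : List (Fin n)) : List ℤ :=
  (List.range (2 ^ mE n)).map fun m => (NofRT (reachTable n (cfgM n m)) o rel : ℤ) - 4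

/-- `rawSepLow` from the shared reach tables. [this work] -/
theorem rawSepLow_eq_map (n : ℕ) (o : Fin n) (rel : List (Fin n)) (a b : Fin n) :
    (baseRT n).map (sepLowOfRT o rel a b) = rawSepLow n o rel a b := by
  unfold baseRT rawSepLow; rw [List.map_map]; rfl

/-- `rawH` from the shared reach tables. [this work] -/
theorem rawH_eq_map (n : ℕ) (o : Fin n) (rel : List (Fin n)) :
    (baseRT n).map (fun rt => (NofRT rt o rel : ℤ) - 4) = rawH n o rel := by
  unfold baseRT rawH; rw [List.map_map]; rfl

/-- Length of `rawSepLow`. [this work] -/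
theorem length_rawSepLow (o : Fin n) (rel : List (Fin n)) (a b : Fin n) :
    (rawSepLow n o rel a b).length = 2 ^ mE n := by simp [rawSepLow]

/-- Length of `rawH`. [this work] -/
theorem length_rawH (o : Fin n) (rel : List (Fin n)) : (rawH n o rel).length = 2 ^ mE n := by simp [rawH]

/-- `NofCfg (cfg g) = Ncount g` for a duplicate-free relay list. [this work] -/
theorem NofCfg_cfg (g : Fin (mE n) → Bool) (o : Fin n) (rel : List (Fin n)) (hrel : rel.Nodup) :
    NofCfg (cfg g) o rel = Ncount g o rel.toFinset := by
  unfold NofCfg Ncount connB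
  rw [← List.toFinset_card_of_nodup (hrel.filter _), List.toFinset_filter]

/-- Entries of `rawSepLow`. [this work] -/
theorem tabOf_rawSepLow (o : Fin n) (rel : List (Fin n)) (hrel : rel.Nodup) (a b : Fin n)
    (g : Fin (mE n) → Bool) :
    tabOf (rawSepLow n o rel a b) g =
      (if connB g a b then 0 else 1) -
        (if 1 ≤ Ncount g o rel.toFinset ∧ Ncount g o rel.toFinset ≤ 2 then 1 else 0) := by
  unfold tabOf rawSepLow sepLowOfRT
  rw [List.getD_eq_getElem?_getD, List.getElem?_map, List.getElem?_range (enc2_lt g)]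
  simp only [Option.map_some, Option.getD_some, cfgM_enc2, ← NofCfg_eq, NofCfg_cfg g o rel hrel]
  rfl

/-- Entries of `rawH`. [this work] -/
theorem tabOf_rawH (o : Fin n) (rel : List (Fin n)) (hrel : rel.Nodup) (g : Fin (mE n) → Bool) :
    tabOf (rawH n o rel) g = (Ncount g o rel.toFinset : ℤ) - 4 := by
  unfold tabOf rawH
  rw [List.getD_eq_getElem?_getD, List.getElem?_map, List.getElem?_range (enc2_lt g)]
  simp only [Option.map_some, Option.getD_some, cfgM_enc2, ← NofCfg_eq, NofCfg_cfg g o rel hrel]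

/-! ## The AND-mask digit test -/

/-- The mask with bit `s·j + (s−1)` set for every `j < L` (top bit of each base-`2^s` digit). [this work] -/
def maskN (s : ℕ) : ℕ → ℕ
  | 0 => 0
  | L + 1 => maskN s L + 2 ^ (s * L + (s - 1))

/-- `maskN s L < 2^(sL)`. [this work] -/
theorem maskN_lt (s : ℕ) (hs : 0 < s) : ∀ L, maskN s L < 2 ^ (s * L)
  | 0 => by simp [maskN]
  | L + 1 => by
    have ih := maskN_lt s hs L
    unfold maskN
    have h1 : 2 ^ (s * L) ≤ 2 ^ (s * L + (s - 1)) := Nat.pow_le_pow_right (by norm_num) (by omega)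
    have h2 : 2 ^ (s * L + (s - 1)) + 2 ^ (s * L + (s - 1)) = 2 ^ (s * (L + 1)) := by
      rw [← two_mul, ← pow_succ']; congr 1; rw [mul_add, mul_one]; omega
    omega

/-- The bits of `maskN`. [this work] -/
theorem testBit_maskN (s : ℕ) (hs : 0 < s) : ∀ L j, j < L → (maskN s L).testBit (s * j + (s - 1)) = true
  | 0, j, hj => absurd hj (Nat.not_lt_zero _)
  | L + 1, j, hj => by
    unfold maskN
    rw [add_comm (maskN s L)]
    rcases Nat.lt_succ_iff_lt_or_eq.1 hj with h | h
    · rw [Nat.testBit_two_pow_add_gt (by nlinarith [h, hs] : s * j + (s - 1) < s * L + (s - 1))]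
      exact testBit_maskN s hs L j h
    · subst h
      rw [Nat.testBit_two_pow_add_eq, Nat.testBit_lt_two_pow]
      · rfl
      · exact lt_of_lt_of_le (maskN_lt s hs j) (Nat.pow_le_pow_right (by norm_num) (by omega))

/-- `maskN` is the offset `2^(s-1) Σ_{j<L} (2^s)^j`. [this work] -/
theorem maskN_eq_sum (s : ℕ) (hs : 0 < s) : ∀ L, (maskN s L : ℤ) = ∑ j ∈ Finset.range L, (2 : ℤ) ^ (s - 1) * (2 ^ s) ^ j
  | 0 => by simp [maskN]
  | L + 1 => by
    unfold maskN
    rw [Finset.sum_range_succ, ← maskN_eq_sum s hs L]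
    push_cast
    congr 1
    rw [← pow_mul, ← pow_add]; congr 1; omega

/-- **AND-mask digit test**: if `N &&& maskN s L = maskN s L` then every base-`2^s` digit `j < L` of `N` is
`≥ 2^(s-1)`. [this work] -/
theorem digit_ge_of_land (s : ℕ) (hs : 0 < s) (L N : ℕ) (h : N &&& maskN s L = maskN s L) (j : ℕ) (hj : j < L) :
    2 ^ (s - 1) ≤ digit (2 ^ s) N j := by
  have hb : N.testBit (s * j + (s - 1)) = true := by
    have := congrArg (fun x => Nat.testBit x (s * j + (s - 1))) h
    simp only [Nat.testBit_and, testBit_maskN s hs L j hj, Bool.and_true] at this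
    exact this
  unfold digit
  rw [← pow_mul]
  apply Nat.ge_two_pow_of_testBit
  rw [Nat.testBit_mod_two_pow, ← Nat.shiftRight_eq_div_pow, Nat.testBit_shiftRight]
  simp only [show s - 1 < s from Nat.sub_lt hs Nat.one_pos, decide_true, Bool.true_and]
  exact hb

/-- Digit criterion with the digit property as hypothesis (variant of `certCoefZ_nonneg_of_digits`). [this work] -/
theorem certCoefZ_nonneg_of_digit_ge {m : ℕ} {P : Type*} [Fintype P] {Λ T : P → (Fin m → Bool) → ℤ}
    {C H : (Fin m → Bool) → ℤ} {s : ℕ} (hs : 0 < s) (hB : CoefBound Λ T C H (2 ^ (s - 1)))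
    (N : ℕ) (hN : (N : ℤ) = certZ (2 ^ s) Λ T C H + ∑ j : Fin (3 ^ m), (2 : ℤ) ^ (s - 1) * (2 ^ s) ^ (j : ℕ))
    (hdig : ∀ j : ℕ, j < 3 ^ m → 2 ^ (s - 1) ≤ digit (2 ^ s) N j) :
    ∀ k, 0 ≤ certCoefZ Λ T C H k := by
  have hK2 : (2 : ℕ) ^ s = 2 * 2 ^ (s - 1) := by
    rw [← pow_succ']; congr 1; omega
  let d : Fin (3 ^ m) → ℕ := fun j => (certCoefZ Λ T C H (finFunctionFinEquiv.symm j) + 2 ^ (s - 1)).toNat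
  have hdnn : ∀ k, 0 ≤ certCoefZ Λ T C H k + 2 ^ (s - 1) := fun k => by
    have := (abs_lt.1 (hB k)).1; push_cast at this ⊢; linarith
  have hK2z : (2 : ℤ) ^ s = 2 * 2 ^ (s - 1) := by exact_mod_cast hK2
  have hdlt : ∀ j, d j < 2 ^ s := fun j => by
    have h1 := (abs_lt.1 (hB (finFunctionFinEquiv.symm j))).2
    have h2 := hdnn (finFunctionFinEquiv.symm j)
    have h3 : ((d j : ℕ) : ℤ) < (2 : ℤ) ^ s := by
      simp only [d]
      rw [Int.toNat_of_nonneg h2, hK2z]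
      push_cast at h1 ⊢
      linarith
    exact_mod_cast h3
  have hNsum : N = ∑ j : Fin (3 ^ m), d j * (2 ^ s) ^ (j : ℕ) := by
    zify
    rw [hN, certZ_eq, ← (Equiv.sum_comp finFunctionFinEquiv.symm
      (fun k => certCoefZ Λ T C H k * ((2 ^ s : ℕ) : ℤ) ^ E3 k)), ← Finset.sum_add_distrib]
    refine Finset.sum_congr rfl fun j _ => ?_
    have hEj : E3 (finFunctionFinEquiv.symm j) = (j : ℕ) := by
      rw [E3_eq, Equiv.apply_symm_apply]
    rw [hEj]
    simp only [d]
    rw [Int.toNat_of_nonneg (hdnn _)]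
    push_cast
    ring
  intro k
  have hj := hdig (finFunctionFinEquiv k) (finFunctionFinEquiv k).2
  rw [hNsum] at hj
  have hj' := hj
  rw [show (finFunctionFinEquiv k : ℕ) = ((finFunctionFinEquiv k : Fin (3 ^ m)) : ℕ) from rfl] at hj'
  have hdd := digit_of_sum _ (pow_pos (by norm_num) s) _ d hdlt (finFunctionFinEquiv k)
  rw [hdd] at hj'
  have h2 := hdnn k
  simp only [d, Equiv.symm_apply_apply] at hj'
  zify at hj'
  rw [Int.toNat_of_nonneg h2] at hj'
  linarith

/-! ## The checker -/

/-- Positive part of an integer list, as naturals. [this work] -/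
def posPart (l : List ℤ) : List ℕ := l.map fun z => z.toNat
/-- Negative part of an integer list, as naturals. [this work] -/
def negPart (l : List ℤ) : List ℕ := l.map fun z => (-z).toNat

/-- Kronecker number of an integer list-table via positive and negative parts. [this work] -/
def krZ (s m : ℕ) (l : List ℤ) : ℤ := (krN s m (posPart l) : ℤ) - krN s m (negPart l)

/-- Maximum absolute value of an integer list. [this work] -/
def maxAbs (l : List ℤ) : ℕ := l.foldr (fun z acc => max z.natAbs acc) 0

/-- Maximum of a list of naturals. [this work] -/
def maxNat (l : List ℕ) : ℕ := l.foldr max 0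

/-- The box certificate CHECK for the instance `(n, o, rel, pairs, box φ)` and the certificate
`(lam, cc)` (nonnegative multiplier tables, as lists indexed by bitmask, box coordinates), base `2^s`. [this work] -/
def boxCheck (n : ℕ) (o : Fin n) (rel : List (Fin n)) (pairs : List (Fin n × Fin n))
    (φ : Fin (mE n) → Fin 3) (s : ℕ) (lam : List (List ℕ)) (cc : List ℕ) : Bool :=
  let m := mE n
  let φZ : Fin m → Bool → Bool → ℤ := fun i => phiZ (φ i)
  let P := pairs.length
  let base := baseRT n
  let Tl : Fin P → List ℤ := fun k => boxTr m φZ (base.map (sepLowOfRT o rel (pairs[k]).1 (pairs[k]).2))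
  let Hl : List ℤ := boxTr m φZ (base.map fun rt => (NofRT rt o rel : ℤ) - 4)
  let Z : ℤ := (List.ofFn fun k : Fin P => (krN s m (lam.getD k []) : ℤ) * krZ s m (Tl k)).sum
    - (krN s m cc : ℤ) * krZ s m Hl
  let off : ℤ := 2 ^ (s - 1) * (((2 : ℤ) ^ (s * 3 ^ m) - 1) / (2 ^ s - 1))
  let bnd : ℕ := 2 ^ m * ((List.ofFn fun k : Fin P => maxNat (lam.getD k []) * maxAbs (Tl k)).sum
    + maxNat cc * maxAbs Hl)
  decide (0 < s) && decide (lam.length = P) && (lam.all fun l => l.length = 2 ^ m)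
    && decide (cc.length = 2 ^ m) && decide (bnd < 2 ^ (s - 1))
    && (lam.any fun l => l.any fun x => 0 < x)
    && decide (0 ≤ Z + off) && decide (((Z + off).toNat &&& off.toNat) = off.toNat)

end Summit.CriticalPhenomena.PercolationContinuityZ3.Theorems.OneCutCert
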